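import Literature.MathematicalPhysics.QuantumFieldTheory.Balaban1983to89.B1Eq323SetPartitions
import Literature.MathematicalPhysics.QuantumFieldTheory.Balaban1983to89.B1Eq324BenfattoMarkov
import HarnessLib

/-!
# `Balaban1983to89.B1Eq324BenfattoSect5Cumulant` — [BenfattoEtAl1978] §5 «Proof of the Basic Lemma», pp. 155–156 and
# p. 159, displays (5.16)–(5.22) and (5.33): THE CHARACTERISTIC FUNCTIONS ELIMINATED and THE CUMULANT EXPANSION TO ORDER t
# WITH ITS A-PRIORI REMAINDER, per box — the two measure-theoretic inequalities of the lower bound (4.7), PROVED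

statement-level skeleton of published theorems with citation tags; proofs where landed; nothing here is a claim about the
Yang–Mills mass gap

WHY THIS MODULE (cell `pub-ymgap`, seat `dag-n08-b`, node N08 «first missing estimate» lane).  The chain is
[Balaban1985UV3] (24) p. 262 / (58) p. 270 ⇐ [Balaban1982Higgs1] (3.24) p. 616 ⇐ [BenfattoEtAl1978] Lemma p. 152
(`B1Eq324BenfattoLemma.BasicLemmaPrinted`, a named fact) ⇐ its §5 proof pp. 153–159 + Appendices A–D.  The Gaussian inputs of
§5 are tree theorems (App. A `B1Eq324BenfattoAppendixA`, App. C Lemma 1/2 `B1Eq324BenfattoAppendixC{,Lemma2}`, (C.2)–(C.8)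
`…AppendixC2`/`…CondCentre`, the Markov property and (5.13) `…Markov`/`…Disintegration`, P̄ = the conditional law `…CondLaw`);
the box/corridor objects (5.5)–(5.11) are the sibling seat's `…Sect5Boxes`.  What §5 does WITH those inputs on pp. 155–156 is
two inequalities of general measure theory, applied box by box: (5.16)–(5.18) remove the characteristic function `χ_□^b` from
the exponential moment at the price `(∫χ)^{exp 2K}`, and (5.21) is the cumulant expansion to order `t` with an A-PRIORI
remainder for a bounded exponent — the bound that `B10Eq24Cumulant` (p. «WHAT IS NOT CERTIFIED: any bound on f⁽ᴺ⁺¹⁾ — the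
a-priori bound available from boundedness alone is volume-useless») deliberately left as the hypothesis `hR` of its
`log_integral_exp_le` / `le_log_integral_exp`: useless on the whole volume, it is exactly right PER BOX `□` of fixed side `b²`,
where print's `K = s₂Ab^{D+2d}` does not grow with `|I|` (the sum over boxes restores the volume factor).  Both are proved
here, the second with the explicit constant `2^{C(n,2)}` (sharper than print's `2^{(t+1)²}(t+1)!·e^{2K}`, which is stated
without derivation and dominates ours: `apriori_le_printed`), and assembled into the per-box factor of (5.22), abstractly and
on print's conditioned free field `condField d α β Γ z̄` with (5.19) taken from the tree's App. C Lemma 2.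

THE PRINTED TEXT (pp. 155–156, p. 159; verbatim from the page images `bcg_p155.png`, `bcg_p156.png`, `bcg_p159.png` of the
lit-balaban store, read as images; ⟦sic⟧ marks print as found).  p. 155, after (5.13): *"We choose 0 < γ < 1 as in Lemma 2
of Appendix C (γ = ½(2d/(α² + 2d))²), and we define* `χ^{Γ₁}_{γb} = χ(|z_Δ| ≦ γb(1 + d(Δ, I)), ∀Δ ∈ Γ₁)`,
`χ_b^□ = χ(|z_Δ| ≦ b(1 + d(Δ, I)), ∀Δ ∈ □′ ∪ Γ₂(□))` (5.14). *Then* `[(5.12)] ≧ ∫P̄(dz_{Γ₁})χ^{Γ₁}_{γb} exp H_{Γ₁}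
(Π_{□∩J=∅} ∫P̄(dz_□|z_{Γ₁})χ_b^□)·(Π_{□∩J≠∅} ∫P̄(dz_□|z_{Γ₁})χ_b^□ exp Ψ_□χ_b^□) ≧ ∫P̄(dz_{Γ₁})χ^{Γ₁}_{γb} exp H_{Γ₁}
(Π_{□∩J=∅} ∫P̄(dz_□|z_{Γ₁})χ_b^□) Π_{□∩J≠∅} {∫P̄(dz_□|z_{Γ₁})e^{Ψ_□χ_b^□} exp[−3b^{2d}e^{−b²/4}e^{2S₂Ab^{D+2d}}]}` (5.15)
*where the ch.f. in the second integral have been eliminated as follows: i) There is a constant s₂ such that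
|Ψ_□χ_b^□| ≦ s₂Ab^{D+2d} as it follows from the assumed structure of H_J.*  p. 156: *ii) we write*
`−log[∫P̄(dz_□|z_{Γ₁})χ_□^b e^{Ψ_□χ_□^b} / ∫P̄(dz_□|z_{Γ₁})e^{Ψ_□χ_□^b}] = ∫₁^∞ du (d/du)(log ∫P̄(dz_□|z_{Γ₁})χ_□^{bu}e^{Ψ_□χ_□^b})
= ∫₁^∞ du [∫P̄(dz_□|z_{Γ₁})((d/du)χ_□^{bu})e^{Ψ_□χ_□^b}] / [∫P̄(dz_□|z_{Γ₁})χ_□^{bu}e^{Ψ_□χ_□^b}]` (5.16). *Since (d/du)χ_□^{bu} is a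
combination with non negative coefficients of δ-functions, and therefore is positive we can extract the factors exp Ψ_□χ_□^b
and perform again the integral:* `[(5.16)] ≦ exp 2s₂Ab^{D+2d}(−log ∫P̄(dz_□|z_{Γ₁})χ_□^b)` (5.17). *Hence*
`∫P̄(dz_□|z_{Γ₁})χ_□^b exp Ψ_□χ_□^b ≧ (∫P̄(dz_□|z_{Γ₁}) exp Ψ_□χ_□^b)·(∫P̄(dz_□|z_{Γ₁})χ_□^b)^{exp 2s₂Ab^{D+2d}}` (5.18). *Finally we use
the lemma on the free field (see Appendix C)* `∫χ_□^b P̄(dz_□|z_{Γ₁}) ≧ exp(−3b^{2d}e^{−b²/4})` (5.19) *to derive the bound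
used in (5.15)* `∫P̄(dz_□|z_{Γ₁})χ_□^b exp Ψ_□χ_□^b ≧ [∫P̄(dz_□|z_{Γ₁}) exp Ψ_□χ_□^b]·exp(−3b^{2d}e^{−b²/4}e^{2s₂Ab^{D+2d}})` (5.20).
*We now try to compute the second integral by a cumulant expansion [see (2.7)] to order t:*
`log ∫P̄(dz_□|z_{Γ₁}) exp Ψ_□χ_□^b = Σ₁ᵗ_k 𝓔̄^T_{z_{Γ₁}}(Ψ_□χ_□^b; k)/k! + [2^{(t+1)²}(t+1)!/(t+1)!] τ (s₂b^{D+2d}A)^{t+1}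
exp 2(s₂Ab^{D+2d})` (5.21) ⟦sic: the un-cancelled `(t+1)!/(t+1)!`; no derivation of the constant is given⟧ *where 𝓔̄_{z_{Γ₁}}
denotes the expectation with respect to P̄(dz_□|z_{Γ₁}) and τ is a function with values in [−1, 1]. Combining (5.21), (5.20)
and (5.15)* `[(5.12)] ≧ ∫P̄(dz_{Γ₁})χ^{Γ₁}_{γb} exp H_{Γ₁}·(Π_{□∩J=∅}∫P̄(dz_□|z_{Γ₁})χ_b^□) Π_{□∩J≠∅}{exp Σ₁ᵗ_k (1/k!)
𝓔^T_{z_{Γ₁}}(Ψ_□χ_□^b; k)·exp −[(2^{(t+1)²}(t+1)!/(t+1)!)(s₂b^{D+2d}A)^{t+1}e^{2s₂Ab^{D+2d}} + 3b^{2d}e^{−b²/4}e^{2s₂Ab^{D+2d}}]}`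
(5.22).  p. 159: *"Each factor in the product sign can be reexpressed using the cumulant formula backwards as*
`∫P̄(dz_□|z_{Γ₁})χ_□^b exp(H_{Γ₂(□)∪Γ₄(□)} + H_{Γ₂(□),Γ₁(□)} − H_{Γ₄(□),Γ₂(□)∖Γ₃(□)})·exp{τ[(2^{(t+1)²}(t+1)!/(t+1)!)
(s₂b^{D+2d}A)^{t+1} exp 2(s₂Ab^{D+2d})]}` (5.33) *where as usual τ is a function with values in [−1, 1]."*

DICTIONARY.  `P̄(dz_□|z_{Γ₁})` ↦ any probability measure `μ` (§1–§4); on print's objects (§5) `condField d α β Γ z̄`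
(`B1Eq324BenfattoLemma`; a probability measure, `B1Eq324BenfattoMarkov.isProbabilityMeasure_condField`).  `χ_□^b` ↦ a measurable
weight `0 ≤ χ ≤ 1` (print's is the indicator of the box small-field event; §4–§5 specialise to indicators, with App. C
Lemma 2's strict `<` in place of (5.14)'s `≦`).  `Ψ_□χ_□^b` ↦ an exponent `X` with `|X| ≤ K` a.e. (print's `K = s₂Ab^{D+2d}`,
point i)).  `𝓔̄^T_{z_{Γ₁}}(X; k)` ↦ `B10Eq24Cumulant.truncExp X μ k` (the `k`-th derivative at 0 of `log ∫e^{θX}dμ`) =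
`B1Eq324BenfattoLemma.truncatedExp μ X k` for `k ≥ 1` (`truncatedExp_eq_truncExp`); `Σ₁ᵗ …/k!` ↦ `cumulantSum μ X t` =
`Σ_{k<t} truncExp X μ (k+1)/(k+1)!` (`cumulantSum_eq_sum_range`).  `|□|` ↦ `box.card` (print: `b^{2d}`).

WHAT IS PROVED (theorems only; no definition, no named fact, no `sorry`; axioms standard).
* §1 **(5.16)–(5.18)**: `rpow_mul_add_mul_sub_le` — the core `p^c(p + c(1−p)) ≤ p` (`c ≥ 1`, `p > 0`; weighted AM–GM, i.e.
  Bernoulli with exponent `1 − c ≤ 0`) — and **`integral_exp_mul_rpow_le_integral_mul_exp`**: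
  `(∫e^X dμ)·(∫χ dμ)^{exp 2K} ≤ ∫χe^X dμ` for a probability measure, `0 ≤ χ ≤ 1`, `|X| ≤ K` a.e.; (5.18) VERBATIM
  (`eq518_printed`: exponent `Ψχ` with `|Ψ| ≤ K` on `{χ ≠ 0}`).  The kernel route replaces print's `u`-interpolation (5.16) by
  the bracket `e^{−K}∫χ ≤ ∫χe^X`, `∫(1−χ)e^X ≤ e^K(1 − ∫χ)` and the core inequality at `c = e^{2K}` — the same (5.17)/(5.18).
* §2 **(5.21)/(5.33), the a-priori remainder**: `abs_iteratedDeriv_mgf_le` (`|Z⁽ⁿ⁾| ≤ BⁿZ`), `iteratedDeriv_succ_cgf_mul_mgf_eq`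
  (the recursion solved for the top cumulant), `one_add_sum_choose_mul_two_pow_le` (the combinatorics
  `1 + Σ_{i<N} C(N,i)2^{C(i+1,2)} ≤ 2^{C(N+1,2)}`), and ★ **`abs_iteratedDeriv_cgf_le`**: for a finite non-zero measure and
  `|V| ≤ B` a.e., `|f⁽ⁿ⁾(t)| ≤ 2^{C(n,2)}·Bⁿ` at EVERY tilt `t` (`n ≥ 1`) — by `B10Eq24Cumulant.truncExp_tilted` a bound on every
  tilted truncated expectation; `abs_truncExp_le`; **`apriori_remainder`** = the hypothesis `hR` of `B10Eq24Cumulant` supplied;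
  `abs_cgf_sub_sum_le_apriori`, `log_integral_exp_le_apriori`, `le_log_integral_exp_apriori` (the two halves of
  [Balaban1982Higgs1] (3.24) with the a-priori remainder `2^{C(N+1,2)}B^{N+1}/(N+1)!`), `abs_log_integral_exp_sub_sum_le`
  (probability measure: two-sided), `apriori_le_printed` (print's constant dominates), ★ **`eq521_printed`** = (5.21)/(5.33) AS
  PRINTED with `τ ∈ [−1, 1]`.
* §3 the same in the typed Basic Lemma's vocabulary: `truncatedExp_eq_truncExp`, `cumulantSum_eq_sum_range`, **`eq521_typed`**,
  `abs_log_integral_exp_sub_cumulantSum_le`.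
* §4 **(5.17), (5.20), (5.22) per box**: `neg_log_div_le` ((5.17) in log form), **`sum_sub_sub_le_log_integral_mul_exp`**
  (`Σ_{k≤t}𝓔^T(X;k)/k! − 2^{C(t+1,2)}K^{t+1}/(t+1)! − e^{2K}W ≤ log ∫χe^X` from a volume input `e^{−W} ≤ ∫χ`), `eq522_printed`
  (print's constants), `integral_exp_mul_exp_neg_le_setIntegral` ((5.20) for an event `A`, `e^{−W} ≤ μ(A)`).
* §5 **on print's conditioned free field**: `exp_neg_three_mul_le` (`e^{−3y} ≤ 1 − 2y`, `0 ≤ y ≤ 1/6`), **`eq519_condField`**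
  ((5.19) from the tree's `appC_lemma2`: `exp(−3|□|e^{−b²/4}) ≤ P̄(S)`), `measurableSet_boxSmallField`, **`eq520_condField`**
  ((5.20) on `condField`, any `|X| ≤ K`), ★ **`eq522_condField`** (the logarithm of the last factor of (5.22) on `condField`
  with `W = 3|□|e^{−b²/4}` and the kernel remainder).

HONEST SCOPE / NOT HERE.  (i) The a-priori constant: print states `2^{(t+1)²}(t+1)!·e^{2K}` without proof; the kernel proves
`2^{C(t+1,2)}` (no `e^{2K}`, no factorial) and derives print's display from it — nothing finer (the sharp constant is
`Σ_{π ∈ 𝒫(n)} (|π|−1)!`, attained) is claimed.  (ii) (5.19) is inherited from `B1Eq324BenfattoAppendixCLemma2.appC_lemma2`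
WITH ITS SIDE CONDITION AS PROVED (`γ(1 + 2d/α²) ≤ ½`, not print's `γ = ½(2d/(α²+2d))²` — the desk-recorded transposition,
referee READ-238) and needs the smallness `|□|e^{−b²/4} ≤ 1/6` (print: inside `b > b*`).  (iii) NOT here: point i)
`|Ψ_□χ_b^□| ≦ s₂Ab^{D+2d}` and (5.11)/(5.24)/(5.34) (structural bounds on `H_J` from (4.5) — the sibling `…Sect5Boxes` line);
the products over boxes in (5.15)/(5.22) (bookkeeping over the pavement `Q^b`, ibid.); (5.23)–(5.32) (joint truncated
expectations, «Leibnitz formula», the Wick/App. D replacement of `𝓔_{z_{Γ₁}}` by `𝓔₀`); the iteration over displaced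
pavements p. 159 and `b* = max{10⁴, γ⁻³b̄}`; the upper bound (5.36).  `BasicLemmaPrinted` stays OPEN.  NOT summit progress;
count-neutral for N08; nothing of [Balaban1985UV3] (41)/(47)/(5) is asserted.
-/

open MeasureTheory ProbabilityTheory Finset
open scoped BigOperators Nat

namespace Literature.MathematicalPhysics.QuantumFieldTheory.Balaban1983to89.B1Eq324BenfattoSect5Cumulant

open _root_.MeasureTheory _root_.ProbabilityTheory
open Literature.MathematicalPhysics.QuantumFieldTheory.Balaban1983to89.B10Eq24Cumulant
open Literature.MathematicalPhysics.QuantumFieldTheory.Balaban1983to89.B1Eq323SetPartitions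
open Literature.MathematicalPhysics.QuantumFieldTheory.Balaban1983to89.B1Eq324BenfattoLemma
open Literature.MathematicalPhysics.QuantumFieldTheory.Balaban1983to89.B1Eq324BenfattoAppendixCLemma2
open Literature.MathematicalPhysics.QuantumFieldTheory.Balaban1983to89.B1Eq324BenfattoMarkov

/-! ## §1  (5.16)–(5.18): the characteristic function eliminated from an exponential moment -/

section ChiRemoval

/-- The real-variable core of (5.17)–(5.18): for `c ≥ 1` and `p > 0`, `p^c·(p + c(1 − p)) ≤ p` (Bernoulli's inequality
with the exponent `1 − c ≤ 0`) — for `p ≤ 1` equivalently `p/(p + c(1 − p)) ≥ p^c`, the worst case of the ratio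
`∫χe^X / ∫e^X` against `(∫χ)^c`.  Weighted AM–GM at the points `p^{1−c}, p` with weights `1/c, 1 − 1/c`.
[cite: BenfattoEtAl1978, (5.17)–(5.18) p.156] -/
theorem rpow_mul_add_mul_sub_le {p c : ℝ} (hc : 1 ≤ c) (hp : 0 < p) :
    p ^ c * (p + c * (1 - p)) ≤ p := by
  have hc0 : 0 < c := lt_of_lt_of_le one_pos hc
  have hw1 : 0 ≤ 1 / c := by positivity
  have hw2 : 0 ≤ 1 - 1 / c := by
    rw [sub_nonneg, div_le_one hc0]
    exact hc
  have hp1c : 0 ≤ p ^ (1 - c) := Real.rpow_nonneg hp.le _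
  have h := Real.geom_mean_le_arith_mean2_weighted hw1 hw2 hp1c hp.le (by ring)
  have hL : (p ^ (1 - c)) ^ (1 / c) * p ^ (1 - 1 / c) = 1 := by
    rw [← Real.rpow_mul hp.le, ← Real.rpow_add hp]
    have : (1 - c) * (1 / c) + (1 - 1 / c) = 0 := by
      field_simp
      ring
    rw [this, Real.rpow_zero]
  rw [hL] at h
  have hpc : 0 < p ^ c := Real.rpow_pos_of_pos hp c
  have e1 : p ^ c * p ^ (1 - c) = p := by
    rw [← Real.rpow_add hp]
    simp
  have key : c * p ^ c ≤ p + (c - 1) * (p ^ c * p) := by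
    have h2 := mul_le_mul_of_nonneg_left h (le_of_lt (mul_pos hc0 hpc))
    calc c * p ^ c = c * p ^ c * 1 := by ring
      _ ≤ c * p ^ c * (1 / c * p ^ (1 - c) + (1 - 1 / c) * p) := h2
      _ = p ^ c * p ^ (1 - c) + (c - 1) * (p ^ c * p) := by
          field_simp
      _ = p + (c - 1) * (p ^ c * p) := by rw [e1]
  nlinarith [key, hpc.le, hp.le]

variable {Ω : Type*} {mΩ : MeasurableSpace Ω} {μ : Measure Ω}

/-- **(5.16)–(5.18), the characteristic functions eliminated** — for a probability measure `P̄`, a weight `0 ≤ χ ≤ 1`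
(print: the indicator `χ_□^b` of (5.14)) and an exponent a.e. bounded by `K` (print: `Ψ_□χ_□^b`, `|Ψ_□χ_□^b| ≦ s₂Ab^{D+2d}`,
point i) p. 155): `(∫ e^X dP̄)·(∫ χ dP̄)^{exp 2K} ≤ ∫ χ e^X dP̄`, i.e. print's (5.18)
`∫P̄ χ exp Ψχ ≧ (∫P̄ exp Ψχ)·(∫P̄ χ)^{exp 2s₂Ab^{D+2d}}`.  Print's route is the `u`-interpolation (5.16)–(5.17); the kernel
route is the two-sided a-priori bracket `e^{−K}∫χ ≤ ∫χe^X`, `∫(1−χ)e^X ≤ e^{K}(1 − ∫χ)` and `rpow_mul_add_mul_sub_le` with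
`c = e^{2K}`. [cite: BenfattoEtAl1978, (5.16)–(5.18) p.156] -/
theorem integral_exp_mul_rpow_le_integral_mul_exp [IsProbabilityMeasure μ] {χ X : Ω → ℝ} {K : ℝ}
    (hχm : Measurable χ) (hχ0 : ∀ ω, 0 ≤ χ ω) (hχ1 : ∀ ω, χ ω ≤ 1)
    (hXm : AEMeasurable X μ) (hXK : ∀ᵐ ω ∂μ, |X ω| ≤ K) :
    (∫ ω, Real.exp (X ω) ∂μ) * (∫ ω, χ ω ∂μ) ^ Real.exp (2 * K) ≤ ∫ ω, χ ω * Real.exp (X ω) ∂μ := by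
  have hK0 : 0 ≤ K := by
    obtain ⟨ω, hω⟩ := hXK.exists
    exact (abs_nonneg _).trans hω
  have heXm : AEStronglyMeasurable (fun ω => Real.exp (X ω)) μ :=
    (Real.measurable_exp.comp_aemeasurable hXm).aestronglyMeasurable
  have heInt : Integrable (fun ω => Real.exp (X ω)) μ :=
    Integrable.mono' (integrable_const (Real.exp K)) heXm (hXK.mono fun ω hω => by
      rw [Real.norm_eq_abs, abs_of_pos (Real.exp_pos _)]
      exact Real.exp_le_exp.2 (abs_le.1 hω).2)
  have hχInt : Integrable χ μ :=
    Integrable.mono' (integrable_const (1 : ℝ)) hχm.aestronglyMeasurable (ae_of_all _ fun ω => by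
      rw [Real.norm_eq_abs, abs_of_nonneg (hχ0 ω)]
      exact hχ1 ω)
  have hχeInt : Integrable (fun ω => χ ω * Real.exp (X ω)) μ :=
    Integrable.mono' heInt (hχm.aestronglyMeasurable.mul heXm) (ae_of_all _ fun ω => by
      rw [Real.norm_eq_abs, abs_mul, abs_of_nonneg (hχ0 ω), abs_of_pos (Real.exp_pos _)]
      exact mul_le_of_le_one_left (Real.exp_pos _).le (hχ1 ω))
  set p := ∫ ω, χ ω ∂μ with hp_def
  set a := ∫ ω, χ ω * Real.exp (X ω) ∂μ with ha_def
  set c := Real.exp (2 * K) with hc_def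
  have hp0 : 0 ≤ p := integral_nonneg hχ0
  have hp1 : p ≤ 1 := (integral_mono hχInt (integrable_const (1 : ℝ)) hχ1).trans (by simp)
  have hc1 : 1 ≤ c := Real.one_le_exp (by positivity)
  have ha : Real.exp (-K) * p ≤ a := by
    rw [hp_def, ← integral_const_mul]
    refine integral_mono_ae (hχInt.const_mul _) hχeInt (hXK.mono fun ω hω => ?_)
    have h1 : Real.exp (-K) ≤ Real.exp (X ω) := Real.exp_le_exp.2 (abs_le.1 hω).1
    have h2 := hχ0 ω
    nlinarith
  have hb : (∫ ω, Real.exp (X ω) ∂μ) - a ≤ Real.exp K * (1 - p) := by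
    rw [ha_def, ← integral_sub heInt hχeInt]
    have hrhs : Real.exp K * (1 - p) = ∫ ω, Real.exp K * (1 - χ ω) ∂μ := by
      rw [integral_const_mul, integral_sub (integrable_const (1 : ℝ)) hχInt]
      simp [hp_def]
    rw [hrhs]
    refine integral_mono_ae (heInt.sub hχeInt) (((integrable_const (1 : ℝ)).sub hχInt).const_mul _)
      (hXK.mono fun ω hω => ?_)
    have h1 : 0 ≤ 1 - χ ω := sub_nonneg.2 (hχ1 ω)
    have h2 : Real.exp (X ω) ≤ Real.exp K := Real.exp_le_exp.2 (abs_le.1 hω).2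
    nlinarith
  rcases hp0.eq_or_lt with hp | hp
  · rw [← hp, Real.zero_rpow (Real.exp_pos _).ne', mul_zero]
    exact integral_nonneg fun ω => mul_nonneg (hχ0 ω) (Real.exp_pos _).le
  · have core := rpow_mul_add_mul_sub_le hc1 hp
    have hpc0 : 0 ≤ p ^ c := Real.rpow_nonneg hp0 _
    have hpc1 : p ^ c ≤ 1 := Real.rpow_le_one hp0 hp1 (by positivity)
    have eK : Real.exp (-K) * c = Real.exp K := by
      rw [hc_def, ← Real.exp_add]
      ring_nf
    have hE : 0 < Real.exp (-K) := Real.exp_pos _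
    have h2 : Real.exp K * (1 - p) * p ^ c ≤ Real.exp (-K) * p * (1 - p ^ c) := by
      have h3 := mul_le_mul_of_nonneg_left core hE.le
      rw [← eK]
      nlinarith [h3]
    have h1 : (∫ ω, Real.exp (X ω) ∂μ) * p ^ c ≤ (a + Real.exp K * (1 - p)) * p ^ c :=
      mul_le_mul_of_nonneg_right (by linarith) hpc0
    calc (∫ ω, Real.exp (X ω) ∂μ) * p ^ c ≤ (a + Real.exp K * (1 - p)) * p ^ c := h1
      _ = a * p ^ c + Real.exp K * (1 - p) * p ^ c := by ring
      _ ≤ a * p ^ c + Real.exp (-K) * p * (1 - p ^ c) := by linarith [h2]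
      _ ≤ a * p ^ c + a * (1 - p ^ c) := by nlinarith [ha, hpc1]
      _ = a := by ring

/-- **(5.18) VERBATIM**: with the exponent `Ψ·χ` itself (print: `Ψ_□χ_□^b`) and `|Ψ| ≤ K` wherever `χ ≠ 0` (point i) p. 155:
`|Ψ_□χ_b^□| ≦ s₂Ab^{D+2d}`): `(∫ e^{Ψχ} dP̄)·(∫ χ dP̄)^{exp 2K} ≤ ∫ χ e^{Ψχ} dP̄`. [cite: BenfattoEtAl1978, (5.18) p.156] -/
theorem eq518_printed [IsProbabilityMeasure μ] {χ Ψ : Ω → ℝ} {K : ℝ}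
    (hχm : Measurable χ) (hχ0 : ∀ ω, 0 ≤ χ ω) (hχ1 : ∀ ω, χ ω ≤ 1)
    (hΨm : AEMeasurable Ψ μ) (hΨK : ∀ ω, χ ω ≠ 0 → |Ψ ω| ≤ K) (hK : 0 ≤ K) :
    (∫ ω, Real.exp (Ψ ω * χ ω) ∂μ) * (∫ ω, χ ω ∂μ) ^ Real.exp (2 * K) ≤
      ∫ ω, χ ω * Real.exp (Ψ ω * χ ω) ∂μ :=
  integral_exp_mul_rpow_le_integral_mul_exp hχm hχ0 hχ1 (hΨm.mul hχm.aemeasurable)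
    (ae_of_all _ fun ω => by
      by_cases h : χ ω = 0
      · rw [h, mul_zero, abs_zero]
        exact hK
      · rw [abs_mul, abs_of_nonneg (hχ0 ω)]
        exact (mul_le_mul (hΨK ω h) (hχ1 ω) (hχ0 ω) hK).trans_eq (mul_one K))

end ChiRemoval

/-! ## §2  (5.21)/(5.33): the a-priori bound on the tilted truncated expectations of a bounded variable -/

section APriori

variable {Ω : Type*} {mΩ : MeasurableSpace Ω} {V : Ω → ℝ} {ν : Measure Ω} {B : ℝ}
variable [IsFiniteMeasure ν]

/-- `|Z⁽ⁿ⁾(t)| ≤ Bⁿ·Z(t)`: the un-normalised tilted moments `∫ Vⁿe^{tV} dν` of a variable with `|V| ≤ B` a.e. — the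
moment input of the a-priori remainder of (5.21) (every moment of `Ψ_□χ_□^b` under any tilted `P̄` is at most `(s₂Ab^{D+2d})ⁿ`).
[cite: BenfattoEtAl1978, (5.21) p.156] -/
theorem abs_iteratedDeriv_mgf_le (hV : AEMeasurable V ν) (hB : ∀ᵐ ω ∂ν, |V ω| ≤ B) (n : ℕ) (t : ℝ) :
    |iteratedDeriv n (mgf V ν) t| ≤ B ^ n * mgf V ν t := by
  rw [iteratedDeriv_mgf_of_abs_le hV hB n t]
  have hint : Integrable (fun ω => V ω ^ n * Real.exp (t * V ω)) ν :=
    integrable_pow_mul_exp_of_mem_interior_integrableExpSet (mem_interior_integrableExpSet_of_abs_le hV hB t) n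
  calc |∫ ω, V ω ^ n * Real.exp (t * V ω) ∂ν| ≤ ∫ ω, |V ω ^ n * Real.exp (t * V ω)| ∂ν :=
        abs_integral_le_integral_abs
    _ ≤ ∫ ω, B ^ n * Real.exp (t * V ω) ∂ν := by
        refine integral_mono_ae hint.abs ((integrable_exp_mul_of_abs_le hV hB t).const_mul _)
          (hB.mono fun ω hω => ?_)
        dsimp only
        rw [abs_mul, abs_of_pos (Real.exp_pos _), abs_pow]
        exact mul_le_mul_of_nonneg_right (pow_le_pow_left₀ (abs_nonneg _) hω n) (Real.exp_pos _).le
    _ = B ^ n * mgf V ν t := by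
        rw [integral_const_mul]
        rfl

/-- The moment–cumulant recursion solved for the top cumulant: `f⁽ⁿ⁺¹⁾Z = Z⁽ⁿ⁺¹⁾ − Σ_{i<n} C(n,i) f⁽ⁱ⁺¹⁾ Z⁽ⁿ⁻ⁱ⁾`
(`B10Eq24Cumulant.iteratedDeriv_succ_mgf` with its `i = n` term moved to the left). [folklore] -/
private theorem iteratedDeriv_succ_cgf_mul_mgf_eq [NeZero ν] (hV : AEMeasurable V ν) (hB : ∀ᵐ ω ∂ν, |V ω| ≤ B)
    (n : ℕ) (t : ℝ) :
    iteratedDeriv (n + 1) (cgf V ν) t * mgf V ν t = iteratedDeriv (n + 1) (mgf V ν) t -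
      ∑ i ∈ Finset.range n,
        (n.choose i : ℝ) * iteratedDeriv (i + 1) (cgf V ν) t * iteratedDeriv (n - i) (mgf V ν) t := by
  rw [iteratedDeriv_succ_mgf hV hB n t, Finset.sum_range_succ, Nat.choose_self, Nat.sub_self, iteratedDeriv_zero,
    Nat.cast_one, one_mul]
  ring

/-- The combinatorial step: `1 + Σ_{i<N} C(N,i)·2^{C(i+1,2)} ≤ 2^{C(N+1,2)}` (bound every `2^{C(i+1,2)}` by `2^{C(N,2)}`,
`Σ_{i≤N} C(N,i) = 2^N`, `C(N+1,2) = C(N,2) + N`). [folklore] -/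
private theorem one_add_sum_choose_mul_two_pow_le (N : ℕ) :
    (1 + ∑ i ∈ Finset.range N, (N.choose i : ℝ) * 2 ^ ((i + 1).choose 2)) ≤ (2 : ℝ) ^ ((N + 1).choose 2) := by
  have hmono : ∀ i ∈ Finset.range N,
      (N.choose i : ℝ) * 2 ^ ((i + 1).choose 2) ≤ (N.choose i : ℝ) * 2 ^ (N.choose 2) := by
    intro i hi
    rw [Finset.mem_range] at hi
    exact mul_le_mul_of_nonneg_left (pow_le_pow_right₀ (by norm_num) (Nat.choose_mono 2 (by omega)))
      (Nat.cast_nonneg _)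
  have h1 : (1 : ℝ) ≤ (N.choose N : ℝ) * 2 ^ (N.choose 2) := by
    rw [Nat.choose_self, Nat.cast_one, one_mul]
    exact one_le_pow₀ (by norm_num)
  calc (1 + ∑ i ∈ Finset.range N, (N.choose i : ℝ) * 2 ^ ((i + 1).choose 2))
      ≤ (N.choose N : ℝ) * 2 ^ (N.choose 2) + ∑ i ∈ Finset.range N, (N.choose i : ℝ) * 2 ^ (N.choose 2) :=
        add_le_add h1 (Finset.sum_le_sum hmono)
    _ = ∑ i ∈ Finset.range (N + 1), (N.choose i : ℝ) * 2 ^ (N.choose 2) := by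
        rw [Finset.sum_range_succ, add_comm]
    _ = 2 ^ N * 2 ^ (N.choose 2) := by
        rw [← Finset.sum_mul]
        congr 1
        have h := Nat.sum_range_choose N
        have h' : (∑ i ∈ Finset.range (N + 1), (N.choose i : ℝ)) = ((∑ i ∈ Finset.range (N + 1), N.choose i : ℕ) : ℝ) := by
          push_cast
          rfl
        rw [h', h]
        push_cast
        rfl
    _ = 2 ^ ((N + 1).choose 2) := by
        rw [← pow_add]
        congr 1
        rw [Nat.choose_succ_succ', Nat.choose_one_right]

/-- **The a-priori bound (the remainder constant of (5.21)/(5.33))**: for a finite non-zero measure `ν` and `|V| ≤ B`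
ν-a.e., EVERY derivative of the cumulant generating function `f(t) = log ∫ e^{tV} dν` obeys, at EVERY tilt `t`,
`|f⁽ⁿ⁾(t)| ≤ 2^{C(n,2)}·Bⁿ` (`n ≥ 1`) — by `B10Eq24Cumulant.truncExp_tilted`, a bound on the `n`-th truncated expectation
of `V` under each interpolating law `e^{tV}ν/Z(t)`, uniform in `t`.  Strong induction on the recursion
`iteratedDeriv_succ_cgf_mul_mgf_eq` with the tilted moments `|Z⁽ʲ⁾/Z| ≤ Bʲ`.  Print's constant for the `(t+1)`-st one,
`2^{(t+1)²}(t+1)!·e^{2K}`, dominates (`apriori_le_printed`). [cite: BenfattoEtAl1978, (5.21) p.156] -/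
theorem abs_iteratedDeriv_cgf_le [NeZero ν] (hV : AEMeasurable V ν) (hB : ∀ᵐ ω ∂ν, |V ω| ≤ B) {n : ℕ}
    (hn : 1 ≤ n) (t : ℝ) : |iteratedDeriv n (cgf V ν) t| ≤ 2 ^ (n.choose 2) * B ^ n := by
  have hB0 : 0 ≤ B := by
    obtain ⟨ω, hω⟩ := hB.exists
    exact (abs_nonneg _).trans hω
  have hZt : 0 < mgf V ν t := mgf_pos_of_abs_le hV hB t
  have hm : ∀ j, |iteratedDeriv j (mgf V ν) t| ≤ B ^ j * mgf V ν t := fun j => abs_iteratedDeriv_mgf_le hV hB j t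
  suffices H : ∀ N j, 1 ≤ j → j ≤ N → |iteratedDeriv j (cgf V ν) t| ≤ 2 ^ (j.choose 2) * B ^ j from
    H n n hn le_rfl
  intro N
  induction N with
  | zero => intro j hj hj0; omega
  | succ N ih =>
    intro j hj hjN
    rcases Nat.lt_or_ge j (N + 1) with hlt | hge
    · exact ih j hj (Nat.lt_succ_iff.mp hlt)
    · obtain rfl : j = N + 1 := le_antisymm hjN hge
      have hrec := iteratedDeriv_succ_cgf_mul_mgf_eq hV hB N t
      have h1 : |iteratedDeriv (N + 1) (cgf V ν) t| * mgf V ν t ≤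
          (1 + ∑ i ∈ Finset.range N, (N.choose i : ℝ) * 2 ^ ((i + 1).choose 2)) * B ^ (N + 1) * mgf V ν t := by
        have habs : |iteratedDeriv (N + 1) (cgf V ν) t| * mgf V ν t =
            |iteratedDeriv (N + 1) (cgf V ν) t * mgf V ν t| := by
          rw [abs_mul, abs_of_pos hZt]
        rw [habs, hrec]
        refine (abs_sub _ _).trans ?_
        have hsum : |∑ i ∈ Finset.range N,
              (N.choose i : ℝ) * iteratedDeriv (i + 1) (cgf V ν) t * iteratedDeriv (N - i) (mgf V ν) t|
            ≤ ∑ i ∈ Finset.range N, (N.choose i : ℝ) * 2 ^ ((i + 1).choose 2) * (B ^ (N + 1) * mgf V ν t) := by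
          refine (Finset.abs_sum_le_sum_abs _ _).trans (Finset.sum_le_sum fun i hi => ?_)
          rw [Finset.mem_range] at hi
          rw [abs_mul, abs_mul, Nat.abs_cast]
          calc (N.choose i : ℝ) * |iteratedDeriv (i + 1) (cgf V ν) t| * |iteratedDeriv (N - i) (mgf V ν) t|
              ≤ (N.choose i : ℝ) * (2 ^ ((i + 1).choose 2) * B ^ (i + 1)) * (B ^ (N - i) * mgf V ν t) := by
                refine mul_le_mul (mul_le_mul_of_nonneg_left (ih (i + 1) (by omega) (by omega))
                  (Nat.cast_nonneg _)) (hm _) (abs_nonneg _) ?_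
                positivity
            _ = (N.choose i : ℝ) * 2 ^ ((i + 1).choose 2) * (B ^ (N + 1) * mgf V ν t) := by
                rw [show N + 1 = (i + 1) + (N - i) by omega, pow_add]
                ring
        calc |iteratedDeriv (N + 1) (mgf V ν) t| +
              |∑ i ∈ Finset.range N,
                (N.choose i : ℝ) * iteratedDeriv (i + 1) (cgf V ν) t * iteratedDeriv (N - i) (mgf V ν) t|
            ≤ B ^ (N + 1) * mgf V ν t +
              ∑ i ∈ Finset.range N, (N.choose i : ℝ) * 2 ^ ((i + 1).choose 2) * (B ^ (N + 1) * mgf V ν t) :=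
              add_le_add (hm _) hsum
          _ = (1 + ∑ i ∈ Finset.range N, (N.choose i : ℝ) * 2 ^ ((i + 1).choose 2)) * B ^ (N + 1) * mgf V ν t := by
              rw [← Finset.sum_mul]
              ring
      have h2 : |iteratedDeriv (N + 1) (cgf V ν) t| ≤
          (1 + ∑ i ∈ Finset.range N, (N.choose i : ℝ) * 2 ^ ((i + 1).choose 2)) * B ^ (N + 1) :=
        le_of_mul_le_mul_right h1 hZt
      calc |iteratedDeriv (N + 1) (cgf V ν) t|
          ≤ (1 + ∑ i ∈ Finset.range N, (N.choose i : ℝ) * 2 ^ ((i + 1).choose 2)) * B ^ (N + 1) := h2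
        _ ≤ 2 ^ ((N + 1).choose 2) * B ^ (N + 1) :=
          mul_le_mul_of_nonneg_right (one_add_sum_choose_mul_two_pow_le N) (pow_nonneg hB0 _)


/-- … at `t = 0`: `|𝓔^T(V; n)| = |⟨Vⁿ⟩ᵀ| ≤ 2^{C(n,2)}·Bⁿ` for the truncated expectations of `B10Eq24Cumulant` (`n ≥ 1`) —
each coefficient of (5.21) is a-priori bounded by the same constant as its remainder. [cite: BenfattoEtAl1978, (5.21) p.156] -/
theorem abs_truncExp_le [NeZero ν] (hV : AEMeasurable V ν) (hB : ∀ᵐ ω ∂ν, |V ω| ≤ B) {n : ℕ} (hn : 1 ≤ n) :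
    |truncExp V ν n| ≤ 2 ^ (n.choose 2) * B ^ n :=
  abs_iteratedDeriv_cgf_le hV hB hn 0

/-- The hypothesis `hR` of `B10Eq24Cumulant.abs_cgf_sub_sum_le` / `log_integral_exp_le` / `le_log_integral_exp` («WHAT IS
NOT CERTIFIED: any bound on `f⁽ᴺ⁺¹⁾`») SUPPLIED with the a-priori constant: `|f⁽ᴺ⁺¹⁾(θ)| ≤ 2^{C(N+1,2)}·B^{N+1}` on `[0, 1]`
(indeed everywhere).  Volume-useless for a Hamiltonian on the whole volume (`B` ∝ |I|, their remark stands); it is what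
[BenfattoEtAl1978] applies PER BOX `□` of fixed side `b²`, where `B = s₂Ab^{D+2d}` does not grow with `|I|`.
[cite: BenfattoEtAl1978, (5.21) p.156] -/
theorem apriori_remainder [NeZero ν] (hV : AEMeasurable V ν) (hB : ∀ᵐ ω ∂ν, |V ω| ≤ B) (N : ℕ) :
    ∀ θ ∈ Set.Icc (0 : ℝ) 1, |iteratedDeriv (N + 1) (cgf V ν) θ| ≤ 2 ^ ((N + 1).choose 2) * B ^ (N + 1) :=
  fun θ _ => abs_iteratedDeriv_cgf_le hV hB (Nat.le_add_left 1 N) θ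

/-- **The cumulant expansion to order `N` with the a-priori remainder**:
`|log ∫e^{V}dν − log ν(univ) − Σ_{n=1}^{N} ⟨Vⁿ⟩ᵀ/n!| ≤ 2^{C(N+1,2)}·B^{N+1}/(N+1)!` (Taylor–Lagrange
`B10Eq24Cumulant.cgf_taylor_lagrange` + `apriori_remainder`). [cite: BenfattoEtAl1978, (5.21) p.156] -/
theorem abs_cgf_sub_sum_le_apriori [NeZero ν] (hV : AEMeasurable V ν) (hB : ∀ᵐ ω ∂ν, |V ω| ≤ B) (N : ℕ) :
    |cgf V ν 1 - cgf V ν 0 - ∑ n ∈ Finset.range N, truncExp V ν (n + 1) / (n + 1)!| ≤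
      2 ^ ((N + 1).choose 2) * B ^ (N + 1) / (N + 1)! :=
  abs_cgf_sub_sum_le hV hB N (apriori_remainder hV hB N)

/-- UPPER HALF for a measure of mass `≤ 1` (the χ-weighted laws of [Balaban1982Higgs1] (3.24)):
`log ∫ e^{V} dν ≤ Σ_{n=1}^{N} ⟨Vⁿ⟩ᵀ/n! + 2^{C(N+1,2)}B^{N+1}/(N+1)!` — `B10Eq24Cumulant.log_integral_exp_le` made
unconditional in its remainder. [cite: BenfattoEtAl1978, (5.21) p.156] -/
theorem log_integral_exp_le_apriori [NeZero ν] (hV : AEMeasurable V ν) (hB : ∀ᵐ ω ∂ν, |V ω| ≤ B)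
    (hmass : ν.real Set.univ ≤ 1) (N : ℕ) :
    Real.log (∫ ω, Real.exp (V ω) ∂ν) ≤
      (∑ n ∈ Finset.range N, truncExp V ν (n + 1) / (n + 1)!) + 2 ^ ((N + 1).choose 2) * B ^ (N + 1) / (N + 1)! :=
  log_integral_exp_le hV hB hmass N (apriori_remainder hV hB N)

/-- LOWER HALF given a volume input `log ν(univ) ≥ −W`:
`Σ_{n=1}^{N} ⟨Vⁿ⟩ᵀ/n! − 2^{C(N+1,2)}B^{N+1}/(N+1)! − W ≤ log ∫ e^{V} dν` — `B10Eq24Cumulant.le_log_integral_exp` made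
unconditional in its remainder. [cite: BenfattoEtAl1978, (5.21) p.156] -/
theorem le_log_integral_exp_apriori [NeZero ν] (hV : AEMeasurable V ν) (hB : ∀ᵐ ω ∂ν, |V ω| ≤ B) (N : ℕ)
    {W : ℝ} (hW : -W ≤ Real.log (ν.real Set.univ)) :
    (∑ n ∈ Finset.range N, truncExp V ν (n + 1) / (n + 1)!) - 2 ^ ((N + 1).choose 2) * B ^ (N + 1) / (N + 1)! - W
      ≤ Real.log (∫ ω, Real.exp (V ω) ∂ν) :=
  le_log_integral_exp hV hB N (apriori_remainder hV hB N) hW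

omit [IsFiniteMeasure ν] in
/-- For a PROBABILITY measure (print's `P̄(dz_□|z_{Γ₁})`) both halves at once:
`|log ∫ e^{V} dν − Σ_{n=1}^{N} ⟨Vⁿ⟩ᵀ/n!| ≤ 2^{C(N+1,2)}B^{N+1}/(N+1)!`. [cite: BenfattoEtAl1978, (5.21) p.156] -/
theorem abs_log_integral_exp_sub_sum_le [IsProbabilityMeasure ν] (hV : AEMeasurable V ν)
    (hB : ∀ᵐ ω ∂ν, |V ω| ≤ B) (N : ℕ) :
    |Real.log (∫ ω, Real.exp (V ω) ∂ν) - ∑ n ∈ Finset.range N, truncExp V ν (n + 1) / (n + 1)!| ≤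
      2 ^ ((N + 1).choose 2) * B ^ (N + 1) / (N + 1)! := by
  have h := abs_cgf_sub_sum_le_apriori hV hB N
  rwa [cgf_one_eq, cgf_zero_eq, probReal_univ, Real.log_one, sub_zero] at h

/-- Print's remainder constant dominates the kernel's: for `B ≥ 0`,
`2^{C(N+1,2)}B^{N+1}/(N+1)! ≤ [2^{(N+1)²}(N+1)!/(N+1)!]·B^{N+1}·e^{2B}` (the bracket exactly as printed in (5.21), with its
un-cancelled `(t+1)!/(t+1)!`). [cite: BenfattoEtAl1978, (5.21) p.156] -/
theorem apriori_le_printed (N : ℕ) {B : ℝ} (hB : 0 ≤ B) :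
    (2 : ℝ) ^ ((N + 1).choose 2) * B ^ (N + 1) / (N + 1)! ≤
      2 ^ ((N + 1) ^ 2) * (N + 1)! / (N + 1)! * B ^ (N + 1) * Real.exp (2 * B) := by
  have hf : ((N + 1)! : ℝ) / (N + 1)! = 1 := div_self (Nat.cast_ne_zero.2 (Nat.factorial_ne_zero _))
  have hf' : (2 : ℝ) ^ ((N + 1) ^ 2) * ((N + 1)! : ℝ) / ((N + 1)! : ℝ) = 2 ^ ((N + 1) ^ 2) := by
    rw [mul_div_assoc, hf, mul_one]
  rw [hf']
  have h1 : (2 : ℝ) ^ ((N + 1).choose 2) ≤ 2 ^ ((N + 1) ^ 2) :=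
    pow_le_pow_right₀ (by norm_num) (Nat.choose_le_pow (N + 1) 2)
  have hBp : 0 ≤ B ^ (N + 1) := pow_nonneg hB _
  calc (2 : ℝ) ^ ((N + 1).choose 2) * B ^ (N + 1) / (N + 1)!
      ≤ 2 ^ ((N + 1).choose 2) * B ^ (N + 1) :=
        div_le_self (by positivity) (Nat.one_le_cast.2 (Nat.one_le_of_lt (Nat.factorial_pos _)))
    _ ≤ 2 ^ ((N + 1) ^ 2) * B ^ (N + 1) := mul_le_mul_of_nonneg_right h1 hBp
    _ = 2 ^ ((N + 1) ^ 2) * B ^ (N + 1) * 1 := (mul_one _).symm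
    _ ≤ 2 ^ ((N + 1) ^ 2) * B ^ (N + 1) * Real.exp (2 * B) :=
        mul_le_mul_of_nonneg_left (Real.one_le_exp (by positivity)) (by positivity)

omit [IsFiniteMeasure ν] in
/-- **(5.21) AS PRINTED** (also (5.33), «the cumulant formula backwards»): for a probability measure `P̄` and an exponent
`X` with `|X| ≤ K` `P̄`-a.e. (print: `X = Ψ_□χ_□^b`, `K = s₂b^{D+2d}A`),
`log ∫ P̄(dz) e^{X} = Σ_{k=1}^{t} 𝓔^T(X; k)/k! + τ·[2^{(t+1)²}(t+1)!/(t+1)!]·K^{t+1}·e^{2K}` with `τ ∈ [−1, 1]`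
— the truncated expectations being those of `P̄` itself (`truncExp X P̄ k`, the Taylor coefficients of `log ∫e^{θX}dP̄`).
[cite: BenfattoEtAl1978, (5.21) p.156 and (5.33) p.159] -/
theorem eq521_printed [IsProbabilityMeasure ν] (hV : AEMeasurable V ν) (hB : ∀ᵐ ω ∂ν, |V ω| ≤ B) (t : ℕ) :
    ∃ τ ∈ Set.Icc (-1 : ℝ) 1, Real.log (∫ ω, Real.exp (V ω) ∂ν) =
      (∑ k ∈ Finset.range t, truncExp V ν (k + 1) / (k + 1)!) +
        τ * (2 ^ ((t + 1) ^ 2) * (t + 1)! / (t + 1)! * B ^ (t + 1) * Real.exp (2 * B)) := by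
  have hB0 : 0 ≤ B := by
    obtain ⟨ω, hω⟩ := hB.exists
    exact (abs_nonneg _).trans hω
  set E : ℝ := 2 ^ ((t + 1) ^ 2) * (t + 1)! / (t + 1)! * B ^ (t + 1) * Real.exp (2 * B) with hE_def
  set R : ℝ := Real.log (∫ ω, Real.exp (V ω) ∂ν) - ∑ k ∈ Finset.range t, truncExp V ν (k + 1) / (k + 1)!
    with hR_def
  have hR : |R| ≤ E := (abs_log_integral_exp_sub_sum_le hV hB t).trans (apriori_le_printed t hB0)
  have hE0 : 0 ≤ E := (abs_nonneg R).trans hR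
  rcases hE0.eq_or_lt with hE | hE
  · refine ⟨0, ⟨by norm_num, by norm_num⟩, ?_⟩
    have hR0 : R = 0 := abs_eq_zero.1 (le_antisymm (hR.trans hE.symm.le) (abs_nonneg _))
    rw [zero_mul, add_zero]
    linarith [hR0]
  · refine ⟨R / E, ⟨?_, ?_⟩, ?_⟩
    · rw [le_div_iff₀ hE]
      linarith [(abs_le.1 hR).1]
    · rw [div_le_iff₀ hE]
      linarith [(abs_le.1 hR).2]
    · rw [div_mul_cancel₀ _ hE.ne', hR_def]
      ring

end APriori

/-! ## §3  (5.21) in the vocabulary of the typed Basic Lemma (`B1Eq324BenfattoLemma.truncatedExp` / `cumulantSum`) -/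

section Typed

variable {d : ℕ} {μ : Measure (B1Eq324BenfattoLemma.Site d → ℝ)} {H : (B1Eq324BenfattoLemma.Site d → ℝ) → ℝ} {K : ℝ}

/-- DICTIONARY: for a probability measure and a bounded `H`, the typed Basic Lemma's `𝓔^T(H; k)`
(`B1Eq324BenfattoLemma.truncatedExp μ H k := cumulantOf (n ↦ ∫ Hⁿ dμ) k`, the cumulants of the moment sequence, (2.7)) IS
`B10Eq24Cumulant.truncExp H μ k` (the `k`-th derivative at `0` of `log ∫ e^{θH} dμ`) for `k ≥ 1`
(`B1Eq323SetPartitions.truncExp_eq_cumulantOf_nmoment`). [cite: BenfattoEtAl1978, (2.7) p.147] -/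
theorem truncatedExp_eq_truncExp [IsProbabilityMeasure μ] (hH : AEMeasurable H μ) (hK : ∀ᵐ z ∂μ, |H z| ≤ K)
    {k : ℕ} (hk : 0 < k) : truncatedExp μ H k = truncExp H μ k := by
  rw [truncExp_eq_cumulantOf_nmoment hH hK hk, truncatedExp]
  congr 1
  funext n
  rw [nmoment, probReal_univ, div_one]

/-- DICTIONARY: the square bracket `Σ_{k=1}^{t} 𝓔^T(H;k)/k!` of (4.6)/(5.21) (`cumulantSum`) is the `Finset.range` sum of
`truncExp` used by `B10Eq24Cumulant`. [cite: BenfattoEtAl1978, (4.6) p.152] -/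
theorem cumulantSum_eq_sum_range [IsProbabilityMeasure μ] (hH : AEMeasurable H μ) (hK : ∀ᵐ z ∂μ, |H z| ≤ K)
    (t : ℕ) : cumulantSum μ H t = ∑ k ∈ Finset.range t, truncExp H μ (k + 1) / (k + 1)! := by
  induction t with
  | zero =>
    rw [cumulantSum, Finset.range_zero, Finset.sum_empty, Finset.Icc_eq_empty (by omega), Finset.sum_empty]
  | succ t ih =>
    rw [Finset.sum_range_succ, ← ih, cumulantSum, cumulantSum, Finset.sum_Icc_succ_top (by omega),
      truncatedExp_eq_truncExp hH hK (Nat.succ_pos t)]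

/-- **(5.21) AS PRINTED, typed vocabulary**: for a probability measure `μ` on configurations and `|H| ≤ K` μ-a.e.,
`log ∫ e^{H} dμ = cumulantSum μ H t + τ·[2^{(t+1)²}(t+1)!/(t+1)!]·K^{t+1}·e^{2K}`, `τ ∈ [−1, 1]`.
[cite: BenfattoEtAl1978, (5.21) p.156] -/
theorem eq521_typed [IsProbabilityMeasure μ] (hH : AEMeasurable H μ) (hK : ∀ᵐ z ∂μ, |H z| ≤ K) (t : ℕ) :
    ∃ τ ∈ Set.Icc (-1 : ℝ) 1, Real.log (∫ z, Real.exp (H z) ∂μ) =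
      cumulantSum μ H t + τ * (2 ^ ((t + 1) ^ 2) * (t + 1)! / (t + 1)! * K ^ (t + 1) * Real.exp (2 * K)) := by
  rw [cumulantSum_eq_sum_range hH hK t]
  exact eq521_printed hH hK t

/-- … and the two-sided kernel form: `|log ∫ e^{H} dμ − cumulantSum μ H t| ≤ 2^{C(t+1,2)}K^{t+1}/(t+1)!`.
[cite: BenfattoEtAl1978, (5.21) p.156] -/
theorem abs_log_integral_exp_sub_cumulantSum_le [IsProbabilityMeasure μ] (hH : AEMeasurable H μ)
    (hK : ∀ᵐ z ∂μ, |H z| ≤ K) (t : ℕ) :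
    |Real.log (∫ z, Real.exp (H z) ∂μ) - cumulantSum μ H t| ≤ 2 ^ ((t + 1).choose 2) * K ^ (t + 1) / (t + 1)! := by
  rw [cumulantSum_eq_sum_range hH hK t]
  exact abs_log_integral_exp_sub_sum_le hH hK t

end Typed

/-! ## §4  (5.17), (5.20), (5.22): the per-box lower bound assembled -/

section PerBox

variable {Ω : Type*} {mΩ : MeasurableSpace Ω} {μ : Measure Ω}

/-- **(5.17)** in log form: `−log(∫χe^X / ∫e^X) ≤ e^{2K}·(−log ∫χ)` whenever `∫χ > 0` (probability measure,
`0 ≤ χ ≤ 1`, `|X| ≤ K` a.e.). [cite: BenfattoEtAl1978, (5.17) p.156] -/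
theorem neg_log_div_le [IsProbabilityMeasure μ] {χ X : Ω → ℝ} {K : ℝ}
    (hχm : Measurable χ) (hχ0 : ∀ ω, 0 ≤ χ ω) (hχ1 : ∀ ω, χ ω ≤ 1)
    (hXm : AEMeasurable X μ) (hXK : ∀ᵐ ω ∂μ, |X ω| ≤ K) (hpos : 0 < ∫ ω, χ ω ∂μ) :
    -Real.log ((∫ ω, χ ω * Real.exp (X ω) ∂μ) / ∫ ω, Real.exp (X ω) ∂μ) ≤
      Real.exp (2 * K) * -Real.log (∫ ω, χ ω ∂μ) := by
  have h := integral_exp_mul_rpow_le_integral_mul_exp hχm hχ0 hχ1 hXm hXK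
  have heInt : Integrable (fun ω => Real.exp (X ω)) μ :=
    Integrable.mono' (integrable_const (Real.exp K))
      (Real.measurable_exp.comp_aemeasurable hXm).aestronglyMeasurable (hXK.mono fun ω hω => by
        rw [Real.norm_eq_abs, abs_of_pos (Real.exp_pos _)]
        exact Real.exp_le_exp.2 (abs_le.1 hω).2)
  have hI : 0 < ∫ ω, Real.exp (X ω) ∂μ := integral_exp_pos heInt
  have hpc : 0 < (∫ ω, χ ω ∂μ) ^ Real.exp (2 * K) := Real.rpow_pos_of_pos hpos _
  have ha : 0 < ∫ ω, χ ω * Real.exp (X ω) ∂μ := lt_of_lt_of_le (mul_pos hI hpc) h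
  have hlog := Real.log_le_log (mul_pos hI hpc) h
  rw [Real.log_mul hI.ne' hpc.ne', Real.log_rpow hpos] at hlog
  rw [Real.log_div ha.ne' hI.ne']
  linarith

/-- **(5.20)/(5.22) assembled, per box**: probability measure `P̄`, weight `0 ≤ χ ≤ 1`, exponent `|X| ≤ K` a.e. (print:
`X = Ψ_□χ_□^b`), and a VOLUME input `e^{−W} ≤ ∫χ dP̄` ((5.19): `W = 3b^{2d}e^{−b²/4}` from App. C Lemma 2):
`Σ_{k=1}^{t} 𝓔^T(X;k)/k! − 2^{C(t+1,2)}K^{t+1}/(t+1)! − e^{2K}·W ≤ log ∫ χ e^{X} dP̄`. [cite: BenfattoEtAl1978, (5.20)–(5.22) p.156] -/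
theorem sum_sub_sub_le_log_integral_mul_exp [IsProbabilityMeasure μ] {χ X : Ω → ℝ} {K W : ℝ}
    (hχm : Measurable χ) (hχ0 : ∀ ω, 0 ≤ χ ω) (hχ1 : ∀ ω, χ ω ≤ 1)
    (hXm : AEMeasurable X μ) (hXK : ∀ᵐ ω ∂μ, |X ω| ≤ K) (hW : Real.exp (-W) ≤ ∫ ω, χ ω ∂μ) (t : ℕ) :
    (∑ k ∈ Finset.range t, truncExp X μ (k + 1) / (k + 1)!) - 2 ^ ((t + 1).choose 2) * K ^ (t + 1) / (t + 1)!
        - Real.exp (2 * K) * W ≤ Real.log (∫ ω, χ ω * Real.exp (X ω) ∂μ) := by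
  have h := integral_exp_mul_rpow_le_integral_mul_exp hχm hχ0 hχ1 hXm hXK
  have heInt : Integrable (fun ω => Real.exp (X ω)) μ :=
    Integrable.mono' (integrable_const (Real.exp K))
      (Real.measurable_exp.comp_aemeasurable hXm).aestronglyMeasurable (hXK.mono fun ω hω => by
        rw [Real.norm_eq_abs, abs_of_pos (Real.exp_pos _)]
        exact Real.exp_le_exp.2 (abs_le.1 hω).2)
  have hpos : 0 < ∫ ω, χ ω ∂μ := (Real.exp_pos _).trans_le hW
  have hI : 0 < ∫ ω, Real.exp (X ω) ∂μ := integral_exp_pos heInt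
  have hpc : 0 < (∫ ω, χ ω ∂μ) ^ Real.exp (2 * K) := Real.rpow_pos_of_pos hpos _
  have hlog := Real.log_le_log (mul_pos hI hpc) h
  rw [Real.log_mul hI.ne' hpc.ne', Real.log_rpow hpos] at hlog
  have hlow := le_log_integral_exp_apriori hXm hXK t (W := 0)
    (by rw [probReal_univ, Real.log_one, neg_zero])
  have hvol : -W ≤ Real.log (∫ ω, χ ω ∂μ) := (Real.le_log_iff_exp_le hpos).2 hW
  have hc : 0 ≤ Real.exp (2 * K) := (Real.exp_pos _).le
  nlinarith [mul_le_mul_of_nonneg_left hvol hc]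

/-- … with PRINT'S constants: `Σ_{k=1}^{t} 𝓔^T(X;k)/k! − [2^{(t+1)²}(t+1)!/(t+1)!]K^{t+1}e^{2K} − W·e^{2K} ≤ log ∫ χ e^{X} dP̄`
— the logarithm of the last factor of (5.22). [cite: BenfattoEtAl1978, (5.22) p.156] -/
theorem eq522_printed [IsProbabilityMeasure μ] {χ X : Ω → ℝ} {K W : ℝ}
    (hχm : Measurable χ) (hχ0 : ∀ ω, 0 ≤ χ ω) (hχ1 : ∀ ω, χ ω ≤ 1)
    (hXm : AEMeasurable X μ) (hXK : ∀ᵐ ω ∂μ, |X ω| ≤ K) (hW : Real.exp (-W) ≤ ∫ ω, χ ω ∂μ) (t : ℕ) :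
    (∑ k ∈ Finset.range t, truncExp X μ (k + 1) / (k + 1)!)
        - 2 ^ ((t + 1) ^ 2) * (t + 1)! / (t + 1)! * K ^ (t + 1) * Real.exp (2 * K)
        - W * Real.exp (2 * K) ≤ Real.log (∫ ω, χ ω * Real.exp (X ω) ∂μ) := by
  have hK0 : 0 ≤ K := by
    obtain ⟨ω, hω⟩ := hXK.exists
    exact (abs_nonneg _).trans hω
  have h := sum_sub_sub_le_log_integral_mul_exp hχm hχ0 hχ1 hXm hXK hW t
  have h2 := apriori_le_printed t hK0
  linarith

/-- SET form of (5.18)/(5.20): for an EVENT `A` (print's `χ_□^b` is an indicator) with `e^{−W} ≤ P̄(A)`: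
`(∫ e^X dP̄)·e^{−W·e^{2K}} ≤ ∫_A e^X dP̄`. [cite: BenfattoEtAl1978, (5.20) p.156] -/
theorem integral_exp_mul_exp_neg_le_setIntegral [IsProbabilityMeasure μ] {X : Ω → ℝ} {K W : ℝ} {A : Set Ω}
    (hA : MeasurableSet A) (hXm : AEMeasurable X μ) (hXK : ∀ᵐ ω ∂μ, |X ω| ≤ K)
    (hW : Real.exp (-W) ≤ μ.real A) :
    (∫ ω, Real.exp (X ω) ∂μ) * Real.exp (-(W * Real.exp (2 * K))) ≤ ∫ ω in A, Real.exp (X ω) ∂μ := by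
  have h := integral_exp_mul_rpow_le_integral_mul_exp (μ := μ) (χ := A.indicator 1) (X := X) (K := K)
    (measurable_one.indicator hA) (fun ω => Set.indicator_nonneg (fun _ _ => zero_le_one) ω)
    (fun ω => Set.indicator_le_self' (fun _ _ => zero_le_one) ω) hXm hXK
  rw [integral_indicator_one hA] at h
  have hind : (fun ω => A.indicator 1 ω * Real.exp (X ω)) = A.indicator fun ω => Real.exp (X ω) := by
    funext ω
    rw [← Set.indicator_mul_left A (1 : Ω → ℝ) (fun ω => Real.exp (X ω))]
    simp
  rw [hind, integral_indicator hA] at h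
  refine le_trans ?_ h
  have hI : 0 ≤ ∫ ω, Real.exp (X ω) ∂μ := integral_nonneg fun ω => (Real.exp_pos _).le
  refine mul_le_mul_of_nonneg_left ?_ hI
  have hexp : Real.exp (-(W * Real.exp (2 * K))) = Real.exp (-W) ^ Real.exp (2 * K) := by
    rw [← Real.exp_mul, neg_mul]
  rw [hexp]
  exact Real.rpow_le_rpow (Real.exp_pos _).le hW (Real.exp_pos _).le

end PerBox

/-! ## §5  (5.19)–(5.20) on print's conditioned free field `P̄(dz_□|z_{Γ₁}) = condField d α β Γ z̄` -/

section CondField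

variable {d : ℕ}

/-- Arithmetic of (5.19): `e^{−3y} ≤ 1 − 2y` for `0 ≤ y ≤ 1/6` (`e^{−3y} ≤ 1/(1 + 3y) ≤ 1 − 2y`), turning App. C Lemma 2's
`1 − 2|□|e^{−b²/4}` into print's `exp(−3b^{2d}e^{−b²/4})` (for `b > b*` the quantity `y = |□|e^{−b²/4}` is minute).
[cite: BenfattoEtAl1978, (5.19) p.156] -/
theorem exp_neg_three_mul_le {y : ℝ} (hy0 : 0 ≤ y) (hy : y ≤ 1 / 6) : Real.exp (-(3 * y)) ≤ 1 - 2 * y := by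
  have h1 : Real.exp (-(3 * y)) ≤ (1 + 3 * y)⁻¹ := by
    rw [Real.exp_neg]
    exact inv_anti₀ (by positivity) (by linarith [Real.add_one_le_exp (3 * y)])
  have h2 : (1 + 3 * y)⁻¹ ≤ 1 - 2 * y := by
    rw [inv_le_iff_one_le_mul₀ (by positivity)]
    nlinarith
  exact h1.trans h2

/-- **(5.19)** «the lemma on the free field (see Appendix C)» in print's exponential form: under the hypotheses of the
tree's App. C Lemma 2 (`B1Eq324BenfattoAppendixCLemma2.appC_lemma2`: `α, β > 0`, `E z_Δ² ≤ ½`, `b > 0`, the tree's side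
condition `γ(1 + 2d/α²) ≤ ½`, conditioning data `|z̄_c| ≤ γb(1 + d(Δ_c, I))` on `Γ`) and `|□|e^{−b²/4} ≤ 1/6`:
`exp(−3|□|e^{−b²/4}) ≤ P̄(|z_Δ| < b(1 + d(Δ, I)) ∀Δ ∈ □ | z̄_Γ)` (print: `|□| = b^{2d}`).
[cite: BenfattoEtAl1978, (5.19) p.156 and Appendix C Lemma 2 p.165] -/
theorem eq519_condField {α β γ b : ℝ} (hα : 0 < α) (hβ : 0 < β) (hvar : freeCov d α β 0 0 ≤ 1 / 2) (hb : 0 < b)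
    (hγ0 : 0 ≤ γ) (hγ : γ * (1 + 2 * d / α ^ 2) ≤ 1 / 2) (Γ I box : Finset (B1Eq324BenfattoLemma.Site d))
    (zbar : B1Eq324BenfattoLemma.Site d → ℝ) (hz : ∀ c ∈ Γ, |zbar c| ≤ γ * b * (1 + distToRegion I c))
    (hsmall : (box.card : ℝ) * Real.exp (-(b ^ 2 / 4)) ≤ 1 / 6) :
    Real.exp (-(3 * ((box.card : ℝ) * Real.exp (-(b ^ 2 / 4))))) ≤
      (condField d α β Γ zbar).real {z | ∀ x ∈ box, |z x| < b * (1 + distToRegion I x)} := by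
  have h := appC_lemma2 hα hβ hvar hb hγ0 hγ Γ I box zbar hz
  refine (exp_neg_three_mul_le (by positivity) hsmall).trans ?_
  linarith

/-- The small-field event of a box is measurable. [cite: BenfattoEtAl1978, (5.14) p.155] -/
theorem measurableSet_boxSmallField (b : ℝ) (I box : Finset (B1Eq324BenfattoLemma.Site d)) :
    MeasurableSet {z : B1Eq324BenfattoLemma.Site d → ℝ | ∀ x ∈ box, |z x| < b * (1 + distToRegion I x)} := by
  have h : {z : B1Eq324BenfattoLemma.Site d → ℝ | ∀ x ∈ box, |z x| < b * (1 + distToRegion I x)} =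
      ⋂ x ∈ box, {z | |z x| < b * (1 + distToRegion I x)} := by
    ext z
    simp only [Set.mem_setOf_eq, Set.mem_iInter]
  rw [h]
  exact MeasurableSet.biInter (Set.to_countable _) fun x _ =>
    measurableSet_lt (continuous_abs.measurable.comp (measurable_pi_apply x)) measurable_const

/-- **(5.20) ON PRINT'S OBJECTS**: for the conditioned free field `P̄ = condField d α β Γ z̄` under the hypotheses of
`eq519_condField`, the box small-field event `S = {|z_Δ| < b(1 + d(Δ,I)) ∀Δ ∈ □}` and ANY exponent `X` with `|X| ≤ K`
`P̄`-a.e. (print: `X = Ψ_□χ_□^b`, `K = s₂Ab^{D+2d}`):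
`(∫ e^{X} dP̄)·exp(−3|□|e^{−b²/4}·e^{2K}) ≤ ∫_S e^{X} dP̄` — print's (5.20)
`∫P̄ χ exp Ψχ ≧ [∫P̄ exp Ψχ]·exp(−3b^{2d}e^{−b²/4}e^{2s₂Ab^{D+2d}})`. [cite: BenfattoEtAl1978, (5.20) p.156] -/
theorem eq520_condField {α β γ b : ℝ} (hα : 0 < α) (hβ : 0 < β) (hvar : freeCov d α β 0 0 ≤ 1 / 2) (hb : 0 < b)
    (hγ0 : 0 ≤ γ) (hγ : γ * (1 + 2 * d / α ^ 2) ≤ 1 / 2) (Γ I box : Finset (B1Eq324BenfattoLemma.Site d))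
    (zbar : B1Eq324BenfattoLemma.Site d → ℝ) (hz : ∀ c ∈ Γ, |zbar c| ≤ γ * b * (1 + distToRegion I c))
    (hsmall : (box.card : ℝ) * Real.exp (-(b ^ 2 / 4)) ≤ 1 / 6)
    {X : (B1Eq324BenfattoLemma.Site d → ℝ) → ℝ} {K : ℝ} (hXm : AEMeasurable X (condField d α β Γ zbar))
    (hXK : ∀ᵐ z ∂condField d α β Γ zbar, |X z| ≤ K) :
    (∫ z, Real.exp (X z) ∂condField d α β Γ zbar) *
        Real.exp (-(3 * ((box.card : ℝ) * Real.exp (-(b ^ 2 / 4))) * Real.exp (2 * K))) ≤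
      ∫ z in {z | ∀ x ∈ box, |z x| < b * (1 + distToRegion I x)}, Real.exp (X z) ∂condField d α β Γ zbar := by
  haveI := isProbabilityMeasure_condField (d := d) hα hβ Γ zbar
  exact integral_exp_mul_exp_neg_le_setIntegral (measurableSet_boxSmallField b I box) hXm hXK
    (eq519_condField hα hβ hvar hb hγ0 hγ Γ I box zbar hz hsmall)

/-- **(5.22)'s last factor ON PRINT'S OBJECTS, in log form**: with `S`, `P̄`, `X`, `K` as in `eq520_condField`,
`Σ_{k=1}^{t} 𝓔^T(χ_S X;k)/k! − 2^{C(t+1,2)}K^{t+1}/(t+1)! − e^{2K}·3|□|e^{−b²/4} ≤ log ∫ χ_S e^{χ_S X} dP̄` — print's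
`∫P̄(dz_□|z_{Γ₁}) e^{Ψ_□χ_□^b}χ_□^b ≥ exp[Σ_k 𝓔^T_{z_{Γ₁}}(Ψ_□χ_□^b;k)/k! − (remainder) − 3b^{2d}e^{−b²/4}e^{2s₂Ab^{D+2d}}]`
(the exponent `χ_S·X` is print's `Ψ_□χ_□^b`, bounded by `K` because `X` is bounded ON `S`).
[cite: BenfattoEtAl1978, (5.22) p.156] -/
theorem eq522_condField {α β γ b : ℝ} (hα : 0 < α) (hβ : 0 < β) (hvar : freeCov d α β 0 0 ≤ 1 / 2) (hb : 0 < b)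
    (hγ0 : 0 ≤ γ) (hγ : γ * (1 + 2 * d / α ^ 2) ≤ 1 / 2) (Γ I box : Finset (B1Eq324BenfattoLemma.Site d))
    (zbar : B1Eq324BenfattoLemma.Site d → ℝ) (hz : ∀ c ∈ Γ, |zbar c| ≤ γ * b * (1 + distToRegion I c))
    (hsmall : (box.card : ℝ) * Real.exp (-(b ^ 2 / 4)) ≤ 1 / 6)
    {X : (B1Eq324BenfattoLemma.Site d → ℝ) → ℝ} {K : ℝ} (hXm : AEMeasurable X (condField d α β Γ zbar))
    (hXK : ∀ z ∈ {z | ∀ x ∈ box, |z x| < b * (1 + distToRegion I x)}, |X z| ≤ K) (hK : 0 ≤ K) (t : ℕ) :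
    let S : Set (B1Eq324BenfattoLemma.Site d → ℝ) := {z | ∀ x ∈ box, |z x| < b * (1 + distToRegion I x)}
    let P := condField d α β Γ zbar
    (∑ k ∈ Finset.range t, truncExp (fun z => S.indicator 1 z * X z) P (k + 1) / (k + 1)!)
        - 2 ^ ((t + 1).choose 2) * K ^ (t + 1) / (t + 1)!
        - Real.exp (2 * K) * (3 * ((box.card : ℝ) * Real.exp (-(b ^ 2 / 4)))) ≤
      Real.log (∫ z, S.indicator 1 z * Real.exp (S.indicator 1 z * X z) ∂P) := by
  intro S P
  haveI : IsProbabilityMeasure P := isProbabilityMeasure_condField (d := d) hα hβ Γ zbar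
  have hS : MeasurableSet S := measurableSet_boxSmallField b I box
  have hχm : Measurable (S.indicator (1 : (B1Eq324BenfattoLemma.Site d → ℝ) → ℝ)) := measurable_one.indicator hS
  have hχ0 : ∀ z, 0 ≤ S.indicator (1 : (B1Eq324BenfattoLemma.Site d → ℝ) → ℝ) z :=
    fun z => Set.indicator_nonneg (fun _ _ => zero_le_one) z
  have hχ1 : ∀ z, S.indicator (1 : (B1Eq324BenfattoLemma.Site d → ℝ) → ℝ) z ≤ 1 :=
    fun z => Set.indicator_le_self' (fun _ _ => zero_le_one) z
  have hYm : AEMeasurable (fun z => S.indicator 1 z * X z) P := (hχm.aemeasurable).mul hXm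
  have hYK : ∀ᵐ z ∂P, |S.indicator (1 : (B1Eq324BenfattoLemma.Site d → ℝ) → ℝ) z * X z| ≤ K := by
    refine ae_of_all _ fun z => ?_
    by_cases hz : z ∈ S
    · rw [Set.indicator_of_mem hz, Pi.one_apply, one_mul]
      exact hXK z hz
    · rw [Set.indicator_of_notMem hz, zero_mul, abs_zero]
      exact hK
  have hW : Real.exp (-(3 * ((box.card : ℝ) * Real.exp (-(b ^ 2 / 4))))) ≤ ∫ z, S.indicator 1 z ∂P := by
    rw [integral_indicator_one hS]
    exact eq519_condField hα hβ hvar hb hγ0 hγ Γ I box zbar hz hsmall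
  exact sum_sub_sub_le_log_integral_mul_exp hχm hχ0 hχ1 hYm hYK hW t

end CondField

end Literature.MathematicalPhysics.QuantumFieldTheory.Balaban1983to89.B1Eq324BenfattoSect5Cumulant
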